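import Literature.AnabelianGeometry.SemiGraphs.TemperedPiPresentationTowerInputs
import Literature.AnabelianGeometry.SemiGraphs.TemperedGroupsLimitFinite
import Mathlib.GroupTheory.OrderOfElement
import HarnessLib

/-!
# Compactness in `π₁^temp(𝒢) = lim_n Gal(𝒢_{∞,n}/𝒢)`: closed with finite level images ⇒ compact;
# Cauchy sequences of the level kernels converge ([SemiAnbd] Prop 3.6 (i) p. 38, Thm 3.7 (iii) p. 41)

Mochizuki, *Semi-graphs of anabelioids*, Publ. RIMS **42** (2006), Prop. 3.6 (i) p. 38 (`π₁^temp(𝒢) :=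
lim_i Gal(𝒢_{∞,i}/𝒢)`, a tempered group) and the proof of Thm. 3.7 (iii) p. 41 ("a compact subgroup
`H ⊆ π₁^temp(𝒢)` … acts … through a finite quotient") [cite: MochizukiSemiAnbd2006, Prop 3.6(i) p.38].

PROOF-ONLY, generic infrastructure over abc-iut-L3-t9's `CountableDiscreteSystem` / `GaloisLevelData`
(cell abc-iut, layer L3; micro-brick «R6-cpt» offered to the FRONTIER programme REFUTE-F1732, steps (2a)/(2b)
of abc-iut-L3-d1's countermodel memo: "z_k → c in Π" and "C := closure⟨c⟩ is compact ≅ ℤ_p", whose holder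
(R6) consumes them by name; equally usable by any seat needing compactness in `π₁^temp`):

* `CountableDiscreteSystem.isCompact_of_isClosed_of_forall_finite_image` — in the limit `lim_i G_i ≤ ∏_i G_i`
  of discrete groups, a CLOSED subset all of whose level images are FINITE is compact (closed inside the
  compact box `∏_i F_i`); converse direction `finite_image_proj_of_isCompact` (continuous image of a compact
  set in a discrete group);
* `GaloisLevelData.isCompact_of_isClosed_of_forall_finite_image` / `finite_image_projAut_of_isCompact` —
  the same at `π₁^temp(𝒢)` with the projections `ρ_n = projAut n`;
* `GaloisLevelData.isCompact_topologicalClosure_zpowers` — if every `ρ_n(g)` has finite order, the closed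
  procyclic subgroup `closure⟨g⟩` is COMPACT; `finite_image_projAut_piPresentation_H/_M` — the level images
  of the presentation's vertex / edge groups are finite (compact images in discrete levels);
* `GaloisLevelData.exists_forall_eventually_projAut_eq` — a sequence `(z_k)` in `π₁^temp` whose level-`n`
  images are EVENTUALLY CONSTANT for every `n` has a limit `g` with `ρ_n(g) = ρ_n(z_k)` for `k ≫ n`
  (completeness of the limit for its level kernels, `temperedPi_complete_projAut`).

Nothing here refers to the IUT corpus; no side is taken on [IUTchIII] Cor 3.12.
-/

namespace Literature.AnabelianGeometry.SemiGraphs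

open Topology

universe u

/-! ### Generic: the limit of discrete groups -/

namespace CountableDiscreteSystem

variable (S : CountableDiscreteSystem.{u})

/-- **Closed with finite level images ⇒ compact** in `lim_i G_i` (`G_i` discrete): the set lies in the
compact box `∏_i ρ_i(C)` and is closed there. [cite: MochizukiSemiAnbd2006, Prop 3.6(i) p.38] -/
theorem isCompact_of_isClosed_of_forall_finite_image (C : Set S.limit) (hC : IsClosed C)
    (hfin : ∀ i, (S.proj i '' C).Finite) : IsCompact C := by
  have hce : Topology.IsClosedEmbedding (Subtype.val : S.limit → ∀ i, S.obj i) :=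
    S.isClosed_limit.isClosedEmbedding_subtypeVal
  -- the compact box of the level images
  have hK : IsCompact (Set.univ.pi fun i => S.proj i '' C) :=
    isCompact_univ_pi fun i => (hfin i).isCompact
  have hsub : Subtype.val '' C ⊆ Set.univ.pi fun i => S.proj i '' C := by
    rintro _ ⟨x, hx, rfl⟩ i -
    exact ⟨x, hx, rfl⟩
  have hcl : IsClosed (Subtype.val '' C) := hce.isClosedMap C hC
  exact hce.isInducing.isCompact_iff.mpr (hK.of_isClosed_subset hcl hsub)

/-- Conversely the level images of a compact set are finite (discrete levels).
[cite: MochizukiSemiAnbd2006, Thm 3.7(iii) p.41] -/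
theorem finite_image_proj_of_isCompact {C : Set S.limit} (hC : IsCompact C) (i : S.ι) :
    (S.proj i '' C).Finite :=
  (hC.image (S.continuous_proj i)).finite_of_discrete

end CountableDiscreteSystem

/-! ### At the Galois tower: `π₁^temp(𝒢)` -/

namespace ProfiniteSemiGraph

namespace GaloisLevelData

open CategoryTheory

variable {𝒢 : ProfiniteSemiGraph.{u}} (D : GaloisLevelData 𝒢) (h𝒢 : 𝒢.IsCountable)

/-- **Closed with finite level images ⇒ compact** in `π₁^temp(𝒢)`.
[cite: MochizukiSemiAnbd2006, Prop 3.6(i) p.38] -/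
theorem isCompact_of_isClosed_of_forall_finite_image (C : Set (D.temperedPi h𝒢)) (hC : IsClosed C)
    (hfin : ∀ n, (D.projAut h𝒢 n '' C).Finite) : IsCompact C :=
  (D.system h𝒢).isCompact_of_isClosed_of_forall_finite_image C hC fun i => hfin i.down

/-- The level images `ρ_n(C)` of a compact `C ⊆ π₁^temp(𝒢)` are finite.
[cite: MochizukiSemiAnbd2006, Thm 3.7(iii) p.41] -/
theorem finite_image_projAut_of_isCompact {C : Set (D.temperedPi h𝒢)} (hC : IsCompact C) (n : ℕ) :
    (D.projAut h𝒢 n '' C).Finite :=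
  (D.system h𝒢).finite_image_proj_of_isCompact hC ⟨n⟩

/-- **A closed procyclic subgroup with finite-order level images is compact**: if every `ρ_n(g)` has
finite order then `closure⟨g⟩ ⊆ π₁^temp(𝒢)` is compact. [cite: MochizukiSemiAnbd2006, Thm 3.7(iii) p.41] -/
theorem isCompact_topologicalClosure_zpowers (g : D.temperedPi h𝒢)
    (hg : ∀ n, IsOfFinOrder (D.projAut h𝒢 n g)) :
    IsCompact ((Subgroup.zpowers g).topologicalClosure : Set (D.temperedPi h𝒢)) := by
  refine D.isCompact_of_isClosed_of_forall_finite_image h𝒢 _ (Subgroup.isClosed_topologicalClosure _)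
    fun n => ?_
  -- `ρ_n(closure ⟨g⟩) ⊆ closure (ρ_n ⟨g⟩) = ⟨ρ_n g⟩`, a finite set (read in the discrete `Gal_n`)
  change (D.proj h𝒢 n '' ((Subgroup.zpowers g).topologicalClosure : Set (D.temperedPi h𝒢))).Finite
  have h1 : D.proj h𝒢 n '' ((Subgroup.zpowers g).topologicalClosure : Set (D.temperedPi h𝒢)) ⊆
      closure (D.proj h𝒢 n '' (Subgroup.zpowers g : Set (D.temperedPi h𝒢))) :=
    image_closure_subset_closure_image (D.continuous_proj h𝒢 n)
  have h2 : D.proj h𝒢 n '' (Subgroup.zpowers g : Set (D.temperedPi h𝒢)) =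
      (Subgroup.zpowers (D.proj h𝒢 n g) : Set (D.Gal h𝒢 n)) := by
    rw [← Subgroup.coe_map, MonoidHom.map_zpowers]
  rw [h2, (isClosed_discrete (Subgroup.zpowers (D.proj h𝒢 n g) : Set (D.Gal h𝒢 n))).closure_eq] at h1
  refine Set.Finite.subset ?_ h1
  have hg' : IsOfFinOrder (D.proj h𝒢 n g) := hg n
  rw [← hg'.powers_eq_zpowers]
  exact hg'.finite_powers

/-- The level images of the VERTEX groups `H_w = D_t(Π_w)` of abc-iut-L3-d4's presentation are finite
("decomposition groups at a finite level are finite quotients of `Π_w`").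
[cite: MochizukiSemiAnbd2006, Thm 3.7(i) p.40] -/
theorem finite_image_projAut_piPresentation_H (T : ∀ w : 𝒢.graph.Vertex, D.PointSeq h𝒢 w)
    (R : SemiGraph.RefBranches 𝒢.graph) (w : 𝒢.graph.Vertex) (n : ℕ) :
    (D.projAut h𝒢 n '' (((D.piPresentation h𝒢 T R).H w : Subgroup (D.temperedPi h𝒢)) :
      Set (D.temperedPi h𝒢))).Finite :=
  D.finite_image_projAut_of_isCompact h𝒢 (D.isCompact_piPresentation_H h𝒢 T R w) n

/-- The level images of the EDGE groups `M_e` of the presentation are finite.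
[cite: MochizukiSemiAnbd2006, Thm 3.7(i) p.40] -/
theorem finite_image_projAut_piPresentation_M (T : ∀ w : 𝒢.graph.Vertex, D.PointSeq h𝒢 w)
    (R : SemiGraph.RefBranches 𝒢.graph) (e : 𝒢.graph.Edge) (n : ℕ) :
    (D.projAut h𝒢 n '' (((D.piPresentation h𝒢 T R).M e : Subgroup (D.temperedPi h𝒢)) :
      Set (D.temperedPi h𝒢))).Finite :=
  D.finite_image_projAut_of_isCompact h𝒢 (D.isCompact_piPresentation_M h𝒢 T R e) n

/-! ### Convergence of level-wise eventually constant sequences -/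

/-- Eventual constancy at one level, from the successor form. [folklore] -/
private theorem eventually_const_of_succ {α : Type*} (f : ℕ → α) {N : ℕ}
    (h : ∀ n, N ≤ n → f (n + 1) = f n) : ∀ n, N ≤ n → f n = f N := by
  intro n hn
  induction n, hn using Nat.le_induction with
  | base => rfl
  | succ k hk ih => rw [h k hk, ih]

/-- **A sequence in `π₁^temp(𝒢)` whose level images are eventually constant converges**: if for every
`n` there is `N` with `ρ_n(z_{k+1}) = ρ_n(z_k)` for `k ≥ N`, then some `g ∈ π₁^temp(𝒢)` has
`ρ_n(g) = ρ_n(z_k)` for all `k ≥ N(n)` (completeness of the limit for its level kernels).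
[cite: MochizukiSemiAnbd2006, Prop 3.6(i) p.38] -/
theorem exists_forall_eventually_projAut_eq (z : ℕ → D.temperedPi h𝒢)
    (hz : ∀ n, ∃ N, ∀ k, N ≤ k → D.projAut h𝒢 n (z (k + 1)) = D.projAut h𝒢 n (z k)) :
    ∃ g : D.temperedPi h𝒢, ∀ n, ∃ N, ∀ k, N ≤ k → D.projAut h𝒢 n g = D.projAut h𝒢 n (z k) := by
  choose N hN using hz
  -- a monotone majorant of `N`
  let M : ℕ → ℕ := fun n => (Finset.range (n + 1)).sup N
  have hNM : ∀ n, N n ≤ M n := fun n => Finset.le_sup (f := N) (Finset.self_mem_range_succ n)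
  have hMmono : Monotone M := fun i j hij => Finset.sup_mono (Finset.range_mono (Nat.succ_le_succ hij))
  -- eventual constancy at level `n` from `N n` on
  have hconst : ∀ n k, N n ≤ k → D.projAut h𝒢 n (z k) = D.projAut h𝒢 n (z (N n)) :=
    fun n => eventually_const_of_succ (fun k => D.projAut h𝒢 n (z k)) (hN n)
  -- the subsequence `w n := z (M n)` is Cauchy for the level kernels
  obtain ⟨g, hg⟩ := D.temperedPi_complete_projAut h𝒢 (fun n => z (M n)) (by
    intro i j hij
    rw [MonoidHom.mem_ker, map_mul, map_inv, inv_mul_eq_one]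
    rw [hconst i (M j) ((hNM i).trans (hMmono hij)), hconst i (M i) (hNM i)])
  refine ⟨g, fun n => ⟨N n, fun k hk => ?_⟩⟩
  have h1 := hg n
  rw [MonoidHom.mem_ker, map_mul, map_inv, inv_mul_eq_one] at h1
  -- `ρ_n g = ρ_n (z (M n)) = ρ_n (z (N n)) = ρ_n (z k)`
  rw [h1, hconst n (M n) (hNM n), hconst n k hk]

end GaloisLevelData

end ProfiniteSemiGraph

end Literature.AnabelianGeometry.SemiGraphs
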